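import Literature.NumberTheory.EllipticCurves.GrossPointsPicardActionFree
import Literature.NumberTheory.EllipticCurves.GrossPointsPicardActionHeegner
import Literature.NumberTheory.Automorphic.BrandtTraceOptimalEmbeddings
import HarnessLib

/-!
# The set `H(c)` of Gross points of conductor `c` is finite, and `h(𝒪_c) ≤ #H(c)`
# (Bertolini–Darmon 1996, Lemma 2.5; Gross 1987 §3)

Topic `NumberTheory/EllipticCurves` (sequel of `GrossPoints.lean`, `GrossPointsPicardActionFree.lean`).
Namespace `Literature.NumberTheory.EllipticCurves.GrossSpace`. THEOREMS ONLY (no definition, no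
named fact, no `sorry`, no instance).

Bertolini–Darmon, Invent. Math. 126 (1996), Lemma 2.5 (1): *"There are exactly `2^t h` Heegner
points of conductor `c` on `X_{N⁺,N⁻}`"* (`h = #Pic(𝒪)`; proof sketch: "the group `Pic(𝒪) × W`
acts simply transitively on the set `H_N(K; c)` of Heegner points", after Eichler, cf. [Vi], [Gr2]).
In particular `H_N(K; c)` is FINITE. In the tree's ideal-theoretic model
(`grossPoints K S c ⊆ GrossSpace S.D K = Dˣ \ {(f, I)}`) we prove the finiteness directly and
record the lower bound coming from the free `Pic(𝒪_c)`-action: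

* §1 `finite_grossPoints` — **`H(c)` is finite**: every point is `[(f, I_i)]` with `I_i` the fixed
  representative of a class `i ∈ Cls O` (finitely many, `Brandt.finite_classSet`) and `f` optimal
  for `𝒪_c` into `O_L(I_i)`; `f` is determined by `f(u)` for any `u ∈ 𝒪_c ∖ ℚ` (`K = ℚ + ℚu`), and
  `f(u)` lies in the finite set `{x ∈ O_L(I_i) : trd x = t, nrd x = n}` (`Brandt.finite_traceNormSet`,
  `D` totally definite), `(t, n)` being the trace and norm of `u`, the same for every `f`
  (`reducedTrace_reducedNorm_apply_eq`: compare `f(u)² = trd·f(u) − nrd` with `u² = p + qu`).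
* §2 `natCard_classGroup_le_natCard_grossPoints` — **`h(𝒪_c) ≤ #H(c)` as soon as `H(c) ≠ ∅`**
  (the orbit of a point stays in `H(c)` and has `h(𝒪_c)` elements by freeness,
  `GrossSpace.natCard_orbit_picard_eq`; `H(c)` is finite), and `natCard_grossPoints_pos`.

## References
* [BertoliniDarmon1996] M. Bertolini, H. Darmon, *Heegner points on Mumford–Tate curves*, Invent.
  Math. 126 (1996), §2.3 Lemma 2.5 (held `paper:doi-10-1007-s002220050105`, PDF p. 19).
* [Gross1987] B. H. Gross, *Heights and the special values of L-series* (1987), §3 (the `h · 2^t`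
  special points `x` of discriminant `−D`).
* [VignerasLNM800] M.-F. Vignéras, LNM 800 (1980), Ch. III §5 (finiteness of optimal embeddings
  modulo units), Ch. V (definite algebras).
-/

noncomputable section

open scoped Pointwise nonZeroDivisors
open NumberField Literature.NumberTheory.Automorphic

universe u

namespace Literature.NumberTheory.EllipticCurves

namespace GrossSpace

variable {K : Type u} [Field K] [NumberField K] {Nplus Nminus : ℕ}

/-! ### §1 Finiteness of `H(c)` -/

/-- In a quadratic field, `𝒪_c` contains an element outside `ℚ` (`K = Frac 𝒪_c` is not `ℚ`). [folklore] -/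
private theorem exists_mem_quadOrder_not_mem_bot (h2 : Module.finrank ℚ K = 2) (c : ℕ) [NeZero c] :
    ∃ u ∈ quadOrder K c, u ∉ (⊥ : Subalgebra ℚ K) := by
  by_contra! hall
  have hne : (⊥ : Subalgebra ℚ K) ≠ ⊤ := by
    rw [Ne, Subalgebra.bot_eq_top_iff_finrank_eq_one, h2]
    decide
  obtain ⟨v, -, hv⟩ := SetLike.exists_of_lt (lt_top_iff_ne_top.mpr hne)
  obtain ⟨a, b, -, rfl⟩ := IsFractionRing.div_surjective (A := quadOrder K c) v
  obtain ⟨qa, hqa⟩ := Algebra.mem_bot.mp (hall _ a.2)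
  obtain ⟨qb, hqb⟩ := Algebra.mem_bot.mp (hall _ b.2)
  exact hv (Algebra.mem_bot.mpr ⟨qa / qb, by rw [map_div₀, hqa, hqb]; rfl⟩)

/-- `K = ℚ + ℚ u` for `u ∉ ℚ` in the quadratic field `K`. [folklore] -/
private theorem exists_eq_add_smul (h2 : Module.finrank ℚ K = 2) {u : K}
    (hu : u ∉ (⊥ : Subalgebra ℚ K)) (z : K) : ∃ p q : ℚ, z = algebraMap ℚ K p + q • u := by
  have htop : Module.finrank ℚ (⊤ : Subalgebra ℚ K) ≤ 2 := by
    rw [(Subalgebra.topEquiv (R := ℚ) (A := K)).toLinearEquiv.finrank_eq, h2]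
  exact Subalgebra.exists_eq_add_smul_of_finrank_le_two ⊤ htop Algebra.mem_top Algebra.mem_top hu

/-- Coordinates `r + s γ` (`γ ∉ ℚ`) in a `ℚ`-algebra are unique. [folklore] -/
private theorem rat_coords_unique' {D : Type*} [Ring D] [Algebra ℚ D] [Nontrivial D] {γ : D}
    (hγ : γ ∉ (⊥ : Subalgebra ℚ D)) {r s r' s' : ℚ}
    (h : algebraMap ℚ D r + s • γ = algebraMap ℚ D r' + s' • γ) : r = r' ∧ s = s' := by
  have hs : s = s' := by
    by_contra hne
    have hne' : s - s' ≠ 0 := sub_ne_zero.mpr hne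
    apply hγ
    have e : (s - s') • γ = algebraMap ℚ D (r' - r) := by
      rw [sub_smul, map_sub, sub_eq_sub_iff_add_eq_add, add_comm (s • γ)]
      exact h
    have e' : γ = algebraMap ℚ D ((s - s')⁻¹ * (r' - r)) := by
      rw [map_mul, ← e, Algebra.algebraMap_eq_smul_one, smul_mul_assoc, one_mul, smul_smul,
        inv_mul_cancel₀ hne', one_smul]
    exact Algebra.mem_bot.mpr ⟨_, e'.symm⟩
  subst hs
  refine ⟨?_, rfl⟩
  have h' : algebraMap ℚ D r = algebraMap ℚ D r' := add_right_cancel h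
  exact (algebraMap ℚ D).injective h'

/-- The image of `u ∉ ℚ` under an embedding `f : K → D` is not in `ℚ`. [folklore] -/
private theorem apply_not_mem_bot {D : Type*} [Ring D] [Algebra ℚ D] [Nontrivial D] (f : K →ₐ[ℚ] D)
    {u : K} (hu : u ∉ (⊥ : Subalgebra ℚ K)) : f u ∉ (⊥ : Subalgebra ℚ D) := by
  intro h
  obtain ⟨q, hq⟩ := Algebra.mem_bot.mp h
  have hq' : algebraMap ℚ K q = u := by
    apply f.toRingHom.injective
    show f (algebraMap ℚ K q) = f u
    rw [f.commutes q]
    exact hq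
  exact hu (hq' ▸ Algebra.mem_bot.mpr ⟨q, rfl⟩)

/-- **The reduced trace and norm of `f(u)` do not depend on the embedding `f`**: if `u² = p + q u`
in `K` (`u ∉ ℚ`) then `trd f(u) = q` and `nrd f(u) = −p` for every `f : K → D` into the algebra of a
Brandt setup (compare with `x² = trd(x) x − nrd(x)`, tree `mul_self_eq_reducedTrace_mul_sub_reducedNorm`;
`1, f(u)` are independent). [cite: VignerasLNM800, Ch. I §1 (polynôme caractéristique réduit)] -/
theorem reducedTrace_reducedNorm_apply_eq (S : Brandt.XiSetup Nplus Nminus) (f : K →ₐ[ℚ] S.D) {u : K}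
    (hu : u ∉ (⊥ : Subalgebra ℚ K)) {p q : ℚ} (hpq : u * u = algebraMap ℚ K p + q • u) :
    reducedTrace ℚ S.D (f u) = q ∧ reducedNorm ℚ S.D (f u) = -p := by
  haveI : Nontrivial S.D := Module.nontrivial_of_finrank_pos (R := ℚ)
    (by rw [IsQuaternionAlgebra.finrank_eq_four (K := ℚ) (D := S.D)]; norm_num)
  have hfu : f u ∉ (⊥ : Subalgebra ℚ S.D) := apply_not_mem_bot f hu
  have h1 := mul_self_eq_reducedTrace_mul_sub_reducedNorm ℚ S.D (f u)
  have h2 : f u * f u = algebraMap ℚ S.D p + q • f u := by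
    rw [← map_mul, hpq, map_add, map_smul, f.commutes]
  have e : algebraMap ℚ S.D p + q • f u =
      algebraMap ℚ S.D (-reducedNorm ℚ S.D (f u)) + reducedTrace ℚ S.D (f u) • f u := by
    rw [← h2, h1, map_neg, Algebra.smul_def, sub_eq_add_neg, add_comm]
  obtain ⟨hp, hq⟩ := rat_coords_unique' hfu e
  exact ⟨hq.symm, by rw [hp, neg_neg]⟩

/-- **`H(c)` is finite** (Bertolini–Darmon 1996, Lemma 2.5 (1): *"exactly `2^t h` Heegner points of
conductor `c`"*; here only finiteness, for every Brandt setup `S`, every quadratic `K` and every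
`c ≥ 1`): each Gross point is `[(f, I_i)]` for the representative `I_i` of one of the finitely many
ideal classes `i ∈ Cls O` and an embedding `f`, optimal for `𝒪_c` into `O_L(I_i)`, which is pinned
down by `f(u) ∈ {x ∈ O_L(I_i) : trd x = t, nrd x = n}` — a finite set in a definite algebra — for a
fixed `u ∈ 𝒪_c ∖ ℚ`. [cite: BertoliniDarmon1996, §2.3 Lemma 2.5 (1)] [cite: VignerasLNM800, Ch. III §5] -/
theorem finite_grossPoints (S : Brandt.XiSetup Nplus Nminus) (h2 : Module.finrank ℚ K = 2) (c : ℕ)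
    [NeZero c] : (grossPoints K S c).Finite := by
  classical
  obtain ⟨u, hu𝒪, hu⟩ := exists_mem_quadOrder_not_mem_bot h2 c
  obtain ⟨p, q, hpq⟩ := exists_eq_add_smul h2 hu (u * u)
  -- `f ↦ f u` is injective
  have hinj : Function.Injective fun f : K →ₐ[ℚ] S.D => f u := by
    intro f g hfg
    apply AlgHom.ext
    intro z
    obtain ⟨a, b, hz⟩ := exists_eq_add_smul h2 hu z
    have hfg' : f u = g u := hfg
    rw [hz, map_add, map_add, map_smul, map_smul, f.commutes, g.commutes, hfg']
  -- the finite sets of admissible embeddings, one for each ideal class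
  set T : Brandt.ClassSet S.O → Set S.D := fun i => Brandt.traceNormSet (Brandt.ClassSet.rep i) q (-p)
    with hT
  have hTfin : ∀ i, (T i).Finite := fun i =>
    Brandt.finite_traceNormSet S.isTotallyDefinite (Brandt.ClassSet.rep_mem i).1 q (-p)
  have hFfin : ∀ i, ((fun f : K →ₐ[ℚ] S.D => f u) ⁻¹' T i).Finite := fun i =>
    (hTfin i).preimage hinj.injOn
  -- the cover
  refine (Set.finite_iUnion fun i : Brandt.ClassSet S.O =>
    (hFfin i).image fun f : K →ₐ[ℚ] S.D => mk (⟨f, Brandt.ClassSet.rep i⟩ : GrossRep S.D K)).subset ?_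
  rintro x ⟨r, rfl, hr⟩
  rw [Set.mem_iUnion]
  let i : Brandt.ClassSet S.O := Quotient.mk (Brandt.rightClassSetoid S.O) ⟨r.lat, hr.1⟩
  obtain ⟨α, hα⟩ : ∃ α : S.Dˣ, r.lat = α • Brandt.ClassSet.rep i :=
    Quotient.exact (Brandt.ClassSet.mk_rep i)
  refine ⟨i, (unitConj α⁻¹).comp r.emb, ?_, ?_⟩
  · -- `(α⁻¹ f α)(u) ∈ T i`
    have hr' : (α⁻¹ • r).IsHeegner S.O c := (GrossRep.IsHeegner.units_smul_iff S c α⁻¹ r).mpr hr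
    have hlat : (α⁻¹ • r).lat = Brandt.ClassSet.rep i := by
      rw [GrossRep.units_smul_lat, hα, inv_smul_smul]
    refine ⟨?_, reducedTrace_reducedNorm_apply_eq S _ hu hpq⟩
    have h := (hr'.2 u).mpr hu𝒪
    rw [GrossRep.units_smul_emb, hlat] at h
    exact h
  · -- `[(α⁻¹ f α, I_i)] = [(f, I)]`
    show mk ⟨(unitConj α⁻¹).comp r.emb, Brandt.ClassSet.rep i⟩ = mk r
    rw [← mk_units_smul α⁻¹ r]
    congr 1
    ext : 1
    · rfl
    · rw [GrossRep.units_smul_lat, hα, inv_smul_smul]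

/-- `H(c)` as a finite type. [cite: BertoliniDarmon1996, §2.3 Lemma 2.5 (1)] -/
theorem finite_coe_grossPoints (S : Brandt.XiSetup Nplus Nminus) (h2 : Module.finrank ℚ K = 2) (c : ℕ)
    [NeZero c] : Finite (grossPoints K S c) :=
  (finite_grossPoints S h2 c).to_subtype

/-! ### §2 `h(𝒪_c) ≤ #H(c)` -/

/-- **`#H(c) > 0` when `H(c)` is non-empty** (finiteness makes `Nat.card` honest: it is not the
junk value `0` of an infinite type). [cite: BertoliniDarmon1996, §2.3 Lemma 2.5 (1)] -/
theorem natCard_grossPoints_pos (S : Brandt.XiSetup Nplus Nminus) (h2 : Module.finrank ℚ K = 2) (c : ℕ)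
    [NeZero c] (hne : (grossPoints K S c).Nonempty) : 0 < Nat.card (grossPoints K S c) := by
  haveI := finite_coe_grossPoints S h2 c
  haveI : Nonempty (grossPoints K S c) := hne.to_subtype
  exact Nat.card_pos

/-- **`h(𝒪_c) ≤ #H(c)`** for `K` quadratic and `H(c) ≠ ∅`: the `Pic(𝒪_c)`-orbit of any Gross point
of conductor `c` stays in `H(c)` (`picard_smul_mem_grossPoints`) and has exactly `h(𝒪_c)` elements
(freeness, `natCard_orbit_picard_eq`), and `H(c)` is finite (§1) — the factor `h` of BD96 Lemma 2.5 (1)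
`#H_N(K; c) = 2^t h`. [cite: BertoliniDarmon1996, §2.3 Lemma 2.5 (1)] -/
theorem natCard_classGroup_le_natCard_grossPoints (S : Brandt.XiSetup Nplus Nminus)
    (h2 : Module.finrank ℚ K = 2) (c : ℕ) [NeZero c] (hne : (grossPoints K S c).Nonempty) :
    Nat.card (ClassGroup (quadOrder K c)) ≤ Nat.card (grossPoints K S c) := by
  obtain ⟨x, hx⟩ := hne
  rw [← natCard_orbit_picard_eq S h2 hx]
  exact Nat.card_mono (finite_grossPoints S h2 c) fun y hy => by
    obtain ⟨σ, rfl⟩ := MulAction.mem_orbit_iff.mp hy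
    exact picard_smul_mem_grossPoints hx σ

end GrossSpace

end Literature.NumberTheory.EllipticCurves

end
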